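import Literature.AnabelianGeometry.SemiGraphs.PSCSmoothCurveShape
import Literature.AnabelianGeometry.SemiGraphs.PSCSeparatingCoveringsProofs
import HarnessLib

/-!
# Smooth-curve data with ARBITRARY cusp representatives: [CombGC] Prop. 1.2 (i)(ii), Prop. 1.5 (ii) hold

Mochizuki, *A combinatorial version of the Grothendieck conjecture* [CombGC], Tohoku Math. J. **59**
(2007), Def. 1.1 (ii) p. 6: "a vertex (respectively, edge) of `𝔾` determines, UP TO CONJUGATION, a
closed subgroup of `Π_G`"; Prop. 1.2 p. 8; Prop. 1.5 p. 12.
[cite: MochizukiCombGC2007, Def 1.1(ii) p.6] [cite: MochizukiCombGC2007, Prop 1.2(i) p.8]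

PROOF-ONLY sequel of `PSCSmoothCurveShape.lean` (abc-iut-L3-t4; abc-iut cell, layer L3, [CombGC]
non-vacuity programme; seat abc-iut-w5-d195 gen 7, brick «SC-GENUINE-COVERING-CLOSED», part B).  There
the datum-level and origin-level instance forms of the FACT-LIST rows F-0459 (Prop. 1.2 (i)), F-0438
(Prop. 1.2 (ii)), F-0443 (Prop. 1.5 (ii)) at smooth-curve-shaped data take the cusp groups to be
EXACTLY the closed cusp inertia groups `closure ι⟨c_{e c}⟩` of the pro-`Σ` completion `ι : Γ_{g,r} → Π`.
A finite étale covering (`PSCCoveringDatum.restrict`, Def. 1.1 (ii)) picks OTHER representatives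
`δ_c · closure ι⟨c_{e c}⟩ · δ_c⁻¹` of the cuspidal conjugacy classes (`PSCSmoothCurveGenuineRestrict.lean`),
so the covering-closed genuine smooth-curve origin needs the same instance forms under the RELAXED clause
`∃ δ_c, Π_c = δ_c • closure ι⟨c_{e c}⟩` — which is what is proved here (primed names), by the same
arguments: every statement is about CONJUGATES of the cusp groups, and the tree's malnormality theorem
`proSigmaCuspInertiaMalnormal_holds` ([SemiAnbd] Ex. 2.10 / [AbsAnab] Lem. 1.3.7, proved) is
conjugation-robust.  (Rows F-0440 / F-0461, `edgeLikeIncidenceHolds_of_vertGp_eq_top` /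
`unrVerticialIffHolds_of_vertGp_eq_top`, do not mention the cusp clause at all; rows F-2827 / F-2829
under the relaxed clause are abc-iut-f-166's `PSCSeparatingCoveringsSmoothCurveRepresentatives.lean`.)
Instance forms at GENUINE anabelian data; consistency evidence for the typed schemata, not the printed
theorems for all pointed stable curves; 0 definitions; nothing here takes a side on [IUTchIII] Cor. 3.12.
-/

noncomputable section

namespace Literature.AnabelianGeometry.SemiGraphs

namespace PSCDatum

open scoped Pointwise
open Literature.GroupTheory.CombinatorialGroupTheory
open SemiGraphOfAnabelioids (IsProSigmaCompletion proSigmaCuspInertiaMalnormal_holds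
  cuspInertia_closure_isCommensurablyTerminal)

universe u

variable {P : Type u} [Group P] [TopologicalSpace P] [IsTopologicalGroup P]

/-! ### Helpers -/

omit [TopologicalSpace P] [IsTopologicalGroup P] in
/-- `C_Π(Π) = Π`. [folklore] -/
private theorem commensurator_top_eq : Subgroup.Commensurable.commensurator (⊤ : Subgroup P) = ⊤ :=
  eq_top_iff.mpr fun g _ => by
    rw [Subgroup.Commensurable.commensurator_mem_iff, conjAct_smul_top]

omit [TopologicalSpace P] [IsTopologicalGroup P] in
/-- `C(A) = A` gives `C(γAγ⁻¹) = γAγ⁻¹` (private copy of the helper of `PSCSmoothCurveShape.lean`).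
[cite: MochizukiCombGC2007, §0 p.3] -/
private theorem commensurator_smul_eq_of_eq' {A : Subgroup P}
    (hA : Subgroup.Commensurable.commensurator A = A) (γ : ConjAct P) :
    Subgroup.Commensurable.commensurator (γ • A) = γ • A := by
  ext x
  rw [Subgroup.Commensurable.commensurator_mem_iff, Subgroup.mem_pointwise_smul_iff_inv_smul_mem,
    ← mul_smul, Subgroup.Commensurable.commensurable_conj γ⁻¹, ← mul_smul, ← mul_smul,
    inv_mul_cancel, one_smul]
  have hx : γ⁻¹ * (ConjAct.toConjAct x * γ) = ConjAct.toConjAct (γ⁻¹ • x) := by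
    simp [ConjAct.smul_def, mul_assoc]
  rw [hx, ← Subgroup.Commensurable.commensurator_mem_iff, hA]

/-! ### Data of smooth-curve shape with arbitrary cusp representatives -/

section SmoothCurve

variable [CompactSpace P] [T2Space P] [TotallyDisconnectedSpace P]
variable {Sigma : Set ℕ} {g r : ℕ}

/-- Conjugates of the cusp groups of DISTINCT cusps meet trivially — relaxed cusp clause.
[cite: MochizukiCombGC2007, Prop 1.2(i) p.8] -/
theorem smul_cuspGp_inf_smul_cuspGp_eq_bot' (hne : Sigma.Nonempty) (hprime : ∀ p ∈ Sigma, p.Prime)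
    (h : PuncturedSurfaceGroup.IsHyperbolicType g r) (ι : PuncturedSurfaceGroup g r →* P)
    (hι : IsProSigmaCompletion Sigma ι) (G : PSCDatum P) (e : G.graph.C ≃ Fin r)
    (hC : ∀ c, ∃ δ : ConjAct P, G.cuspGp c =
      δ • ((PuncturedSurfaceGroup.cuspInertia (g := g) (e c)).map ι).topologicalClosure) {c₁ c₂ : G.graph.C}
    (hc : c₁ ≠ c₂) (γ₁ γ₂ : ConjAct P) :
    γ₁ • G.cuspGp c₁ ⊓ γ₂ • G.cuspGp c₂ = ⊥ := by
  obtain ⟨δ₁, h₁⟩ := hC c₁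
  obtain ⟨δ₂, h₂⟩ := hC c₂
  have hij : e c₁ ≠ e c₂ := fun h' => hc (e.injective h')
  have hfact := (proSigmaCuspInertiaMalnormal_holds Sigma hne hprime g r h P ι hι (e c₁) (e c₂)).2
    (ConjAct.ofConjAct ((γ₁ * δ₁)⁻¹ * (γ₂ * δ₂))) (Or.inl hij)
  rw [ConjAct.toConjAct_ofConjAct] at hfact
  have := congrArg (fun X : Subgroup P => (γ₁ * δ₁) • X) hfact
  simpa only [h₁, h₂, Subgroup.smul_inf, ← mul_smul, mul_inv_cancel_left, Subgroup.smul_bot] using this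

/-- The cusp groups are infinite — relaxed cusp clause. [cite: MochizukiCombGC2007, Rmk 1.1.3 p.7] -/
theorem infinite_cuspGp' (hne : Sigma.Nonempty) (hprime : ∀ p ∈ Sigma, p.Prime)
    (h : PuncturedSurfaceGroup.IsHyperbolicType g r) (ι : PuncturedSurfaceGroup g r →* P)
    (hι : IsProSigmaCompletion Sigma ι) (G : PSCDatum P) (e : G.graph.C ≃ Fin r)
    (hC : ∀ c, ∃ δ : ConjAct P, G.cuspGp c =
      δ • ((PuncturedSurfaceGroup.cuspInertia (g := g) (e c)).map ι).topologicalClosure) (c : G.graph.C) :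
    Infinite (G.cuspGp c) := by
  obtain ⟨δ, hδ⟩ := hC c
  haveI := (proSigmaCuspInertiaMalnormal_holds Sigma hne hprime g r h P ι hι (e c) (e c)).1
  rw [hδ]
  exact Infinite.of_injective _ (Subgroup.equivSMul δ _).injective

/-- **Prop. 1.2 (i), edge-like case** at smooth-curve data with arbitrary cusp representatives.
[cite: MochizukiCombGC2007, Prop 1.2(i) p.8] -/
theorem edgeLikeOpenInterDeterminesEdge_of_smoothCurve' (hne : Sigma.Nonempty)
    (hprime : ∀ p ∈ Sigma, p.Prime) (h : PuncturedSurfaceGroup.IsHyperbolicType g r)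
    (ι : PuncturedSurfaceGroup g r →* P) (hι : IsProSigmaCompletion Sigma ι) (G : PSCDatum P)
    (e : G.graph.C ≃ Fin r)
    (hC : ∀ c, ∃ δ : ConjAct P, G.cuspGp c =
      δ • ((PuncturedSurfaceGroup.cuspInertia (g := g) (e c)).map ι).topologicalClosure)
    [IsEmpty G.graph.N] : G.EdgeLikeOpenInterDeterminesEdge := by
  intro e₁ e₂ γ₁ γ₂ hopen
  rcases e₁ with n | c₁
  · exact isEmptyElim n
  rcases e₂ with n | c₂
  · exact isEmptyElim n
  by_contra hne12
  have hc : c₁ ≠ c₂ := fun h' => hne12 (by rw [h'])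
  change IsOpen ((((γ₁ • G.cuspGp c₁) ⊓ (γ₂ • G.cuspGp c₂)).subgroupOf (γ₁ • G.cuspGp c₁) :
    Subgroup (γ₁ • G.cuspGp c₁ : Subgroup P)) : Set (γ₁ • G.cuspGp c₁ : Subgroup P)) at hopen
  rw [G.smul_cuspGp_inf_smul_cuspGp_eq_bot' hne hprime h ι hι e hC hc, Subgroup.bot_subgroupOf,
    Subgroup.coe_bot] at hopen
  haveI : DiscreteTopology (γ₁ • G.cuspGp c₁ : Subgroup P) :=
    discreteTopology_iff_isOpen_singleton_one.mpr hopen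
  haveI : CompactSpace (γ₁ • G.cuspGp c₁ : Subgroup P) :=
    isCompact_iff_compactSpace.mp (isClosed_conj_smul (G.isClosed_cuspGp c₁) γ₁).isCompact
  haveI := G.infinite_cuspGp' hne hprime h ι hι e hC c₁
  haveI : Infinite (γ₁ • G.cuspGp c₁ : Subgroup P) :=
    Infinite.of_injective _ (Subgroup.equivSMul γ₁ (G.cuspGp c₁)).injective
  exact (‹Infinite (γ₁ • G.cuspGp c₁ : Subgroup P)›).not_finite finite_of_compact_of_discrete

/-- **Prop. 1.2 (i)** (all three cases) at one-vertex smooth-curve data with arbitrary cusp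
representatives. [cite: MochizukiCombGC2007, Prop 1.2(i) p.8] -/
theorem openInterDeterminesComponent_of_smoothCurve' (hne : Sigma.Nonempty)
    (hprime : ∀ p ∈ Sigma, p.Prime) (h : PuncturedSurfaceGroup.IsHyperbolicType g r)
    (ι : PuncturedSurfaceGroup g r →* P) (hι : IsProSigmaCompletion Sigma ι) (G : PSCDatum P)
    (e : G.graph.C ≃ Fin r)
    (hC : ∀ c, ∃ δ : ConjAct P, G.cuspGp c =
      δ • ((PuncturedSurfaceGroup.cuspInertia (g := g) (e c)).map ι).topologicalClosure)
    [IsEmpty G.graph.N] (v₀ : G.graph.V) (hv : ∀ w, w = v₀) :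
    G.VerticialOpenInterDeterminesVertex ∧ G.EdgeLikeOpenInterDeterminesEdge ∧
      G.UnrVerticialOpenInterDeterminesVertex :=
  ⟨G.verticialOpenInterDeterminesVertex_of_subsingleton v₀ hv,
    G.edgeLikeOpenInterDeterminesEdge_of_smoothCurve' hne hprime h ι hι e hC,
    G.unrVerticialOpenInterDeterminesVertex_of_subsingleton v₀ hv⟩

/-- **Prop. 1.2 (ii)** at smooth-curve data with arbitrary cusp representatives: `Π_v = Π` and every
conjugate of a cusp group are commensurably terminal. [cite: MochizukiCombGC2007, Prop 1.2(ii) p.8] -/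
theorem commensurablyTerminal_of_smoothCurve' (hne : Sigma.Nonempty) (hprime : ∀ p ∈ Sigma, p.Prime)
    (h : PuncturedSurfaceGroup.IsHyperbolicType g r) (ι : PuncturedSurfaceGroup g r →* P)
    (hι : IsProSigmaCompletion Sigma ι) (G : PSCDatum P) (e : G.graph.C ≃ Fin r)
    (hC : ∀ c, ∃ δ : ConjAct P, G.cuspGp c =
      δ • ((PuncturedSurfaceGroup.cuspInertia (g := g) (e c)).map ι).topologicalClosure)
    [IsEmpty G.graph.N] (hV : ∀ v, G.vertGp v = ⊤) (v₀ : G.graph.V) :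
    G.VerticialEdgeLikeCommensurablyTerminal ∧ G.UnrVerticialCommensurablyTerminal := by
  refine ⟨fun A hA => ?_, fun _ B hB => ?_⟩
  · rcases hA with hA | hA | hA
    · rw [(G.isVerticial_iff_eq_top_of_vertGp_eq_top hV v₀ A).mp hA]; exact commensurator_top_eq
    · exact absurd hA (G.not_isNodal_of_isEmpty A)
    · obtain ⟨c, γ, rfl⟩ := hA
      obtain ⟨δ, hδ⟩ := hC c
      rw [hδ, ← mul_smul]
      refine commensurator_smul_eq_of_eq' ?_ (γ * δ)
      exact (cuspInertia_closure_isCommensurablyTerminal hne hprime h ι hι (e c)).commensurator_eq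
  · obtain ⟨A, hA, rfl⟩ := hB
    rw [(G.isVerticial_iff_eq_top_of_vertGp_eq_top hV v₀ A).mp hA, top_sup_eq]
    exact commensurator_top_eq

end SmoothCurve

/-! ### Origin-level instance forms: origins of smooth-curve data with arbitrary representatives -/

section Origin

variable (Ω : PSCOrigin.{u})

/-- **F-0459 / Prop. 1.2 (i)** at every origin whose data are of smooth-curve shape over pro-`Σ`
completions of punctured surface groups (profinite carriers), cusp groups ANY representatives of the
cuspidal conjugacy classes. [cite: MochizukiCombGC2007, Prop 1.2(i) p.8] -/
theorem openInterDeterminesComponentHolds_of_smoothCurve'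
    (hΩ : ∀ ⦃Q : Type u⦄ [Group Q] [TopologicalSpace Q] [IsTopologicalGroup Q] (G : PSCDatum Q),
      Ω.IsOfPSCType G → CompactSpace Q ∧ T2Space Q ∧ TotallyDisconnectedSpace Q ∧ IsEmpty G.graph.N ∧
        (∃ v₀ : G.graph.V, ∀ w, w = v₀) ∧
        ∃ (S : Set ℕ) (g r : ℕ) (ι : PuncturedSurfaceGroup g r →* Q) (e : G.graph.C ≃ Fin r),
          S.Nonempty ∧ (∀ p ∈ S, p.Prime) ∧ PuncturedSurfaceGroup.IsHyperbolicType g r ∧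
          IsProSigmaCompletion S ι ∧
          ∀ c, ∃ δ : ConjAct Q, G.cuspGp c =
            δ • ((PuncturedSurfaceGroup.cuspInertia (g := g) (e c)).map ι).topologicalClosure) :
    OpenInterDeterminesComponentHolds Ω := by
  intro Q _ _ _ G hG
  obtain ⟨_, _, _, _, ⟨v₀, hv⟩, S, g, r, ι, e, hne, hprime, h, hι, hC⟩ := hΩ G hG
  exact G.openInterDeterminesComponent_of_smoothCurve' hne hprime h ι hι e hC v₀ hv

/-- **F-0438 / Prop. 1.2 (ii)** at every origin of smooth-curve data with arbitrary cusp representatives.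
[cite: MochizukiCombGC2007, Prop 1.2(ii) p.8] -/
theorem commensurableTerminalityHolds_of_smoothCurve'
    (hΩ : ∀ ⦃Q : Type u⦄ [Group Q] [TopologicalSpace Q] [IsTopologicalGroup Q] (G : PSCDatum Q),
      Ω.IsOfPSCType G → CompactSpace Q ∧ T2Space Q ∧ TotallyDisconnectedSpace Q ∧ IsEmpty G.graph.N ∧
        (∀ v, G.vertGp v = ⊤) ∧ (∃ v₀ : G.graph.V, ∀ w, w = v₀) ∧
        ∃ (S : Set ℕ) (g r : ℕ) (ι : PuncturedSurfaceGroup g r →* Q) (e : G.graph.C ≃ Fin r),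
          S.Nonempty ∧ (∀ p ∈ S, p.Prime) ∧ PuncturedSurfaceGroup.IsHyperbolicType g r ∧
          IsProSigmaCompletion S ι ∧
          ∀ c, ∃ δ : ConjAct Q, G.cuspGp c =
            δ • ((PuncturedSurfaceGroup.cuspInertia (g := g) (e c)).map ι).topologicalClosure) :
    CommensurableTerminalityHolds Ω := by
  intro Q _ _ _ G hG
  obtain ⟨_, _, _, _, hV, ⟨v₀, -⟩, S, g, r, ι, e, hne, hprime, h, hι, hC⟩ := hΩ G hG
  exact G.commensurablyTerminal_of_smoothCurve' hne hprime h ι hι e hC hV v₀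

/-- **F-0443 / Prop. 1.5 (ii)** at every origin of one-vertex smooth-curve data with arbitrary cusp
representatives, by COMPOSITION with abc-iut-w4-d081's reduction
`graphicIffEdgeLikeVerticialHolds_of_incidence` (Prop. 1.2 (i) + Prop. 1.5 (i); the branch link is
vacuous without nodes). [cite: MochizukiCombGC2007, Prop 1.5(ii) p.13] -/
theorem graphicIffEdgeLikeVerticialHolds_of_smoothCurve'
    (hΩ : ∀ ⦃Q : Type u⦄ [Group Q] [TopologicalSpace Q] [IsTopologicalGroup Q] (G : PSCDatum Q),
      Ω.IsOfPSCType G → CompactSpace Q ∧ T2Space Q ∧ TotallyDisconnectedSpace Q ∧ IsEmpty G.graph.N ∧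
        (∀ v, G.vertGp v = ⊤) ∧ (∃ v₀ : G.graph.V, ∀ w, w = v₀) ∧
        ∃ (S : Set ℕ) (g r : ℕ) (ι : PuncturedSurfaceGroup g r →* Q) (e : G.graph.C ≃ Fin r),
          S.Nonempty ∧ (∀ p ∈ S, p.Prime) ∧ PuncturedSurfaceGroup.IsHyperbolicType g r ∧
          IsProSigmaCompletion S ι ∧
          ∀ c, ∃ δ : ConjAct Q, G.cuspGp c =
            δ • ((PuncturedSurfaceGroup.cuspInertia (g := g) (e c)).map ι).topologicalClosure)
    (hΩ' : ∀ ⦃Q : Type u⦄ [Group Q] [TopologicalSpace Q] (G : PSCDatum Q), Ω.IsOfPSCType G →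
      IsEmpty G.graph.N ∧ (∀ v, G.vertGp v = ⊤) ∧ Nonempty G.graph.V) :
    GraphicIffEdgeLikeVerticialHolds Ω :=
  graphicIffEdgeLikeVerticialHolds_of_incidence Ω
    (openInterDeterminesComponentHolds_of_smoothCurve' Ω fun Q _ _ _ G hG => by
      obtain ⟨h1, h2, h3, h4, -, h6, h7⟩ := hΩ G hG
      exact ⟨h1, h2, h3, h4, h6, h7⟩)
    (edgeLikeIncidenceHolds_of_vertGp_eq_top Ω hΩ')
    (fun Q _ _ _ G hG e => by
      obtain ⟨-, -, -, hN, -⟩ := hΩ G hG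
      exact isEmptyElim e)

end Origin

end PSCDatum

end Literature.AnabelianGeometry.SemiGraphs

end
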